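import Mathlib
import HarnessLib

/-!
# Crux `LogCanQuotLU` (stmt-ResolutionOfSingularities-17082), line `birth`:
# stub `stub_pCyclicGrading` — a `p`-cyclic derivation grades the ring by `ℤ/p`

Route `ResolutionOfSingularities/FoliationDescent`, crux #3 `LogCanQuotLU`. This file proves the
abstract grading stub of the multiplicative half of the line `birth`
(`Sig.stub_pCyclicGrading`, verbatim): for `k` a field of characteristic `p`, `S` a commutative
`k`-algebra and `θ` a `k`-derivation of `S` with `θ^[p] = θ` (pointwise), there is a Mathlib
`GradedAlgebra` structure `S = ⊕_{a ∈ ZMod p} S_a` by `k`-submodules with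
`S_a = {s | θ s = ι a • s}`, where `ι = ZMod.castHom (dvd_refl p) k : ZMod p →+* k`.

Proof (folklore; the infinitesimal form of "a `μ_p`-action is a `ℤ/p`-grading"):
* `S_a` is the eigenspace of the `k`-linear map `θ` for the eigenvalue `ι a`
  (`Module.End.eigenspace`), so the membership clause is `Module.End.mem_eigenspace_iff`.
* `1 ∈ S_0` (`θ 1 = 0`) and `S_a · S_b ⊆ S_{a+b}` by the Leibniz rule: a `SetLike.GradedMonoid`.
* Eigenspaces for the distinct eigenvalues `ι a` (`ι` is injective, `ZMod.castHom_injective`) are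
  independent (`Module.End.eigenspaces_iSupIndep`).
* They span: `θ` is killed by `X ^ p - X = ∏_{a ∈ 𝔽_p} (X - ι a) ∈ k[X]` (the nodal polynomial of
  the nodes `ι`), so the Lagrange interpolation operators `ℓ_a(θ)` split every `s` as
  `s = ∑_a ℓ_a(θ) s` with `ℓ_a(θ) s ∈ S_a` (pattern of the tree's
  `Theorems.Picover.EigenParameters.exists_eigen_sum`).
* Hence `DirectSum.IsInternal S_•`, and `DirectSum.IsInternal.chooseDecomposition` gives the
  decomposition half of the `GradedAlgebra` structure.

Main result: `stub_pCyclicGrading` (registered signature of the line, verbatim). The helper facts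
live in the sub-namespace `PCyclicGrading` (`nodal_univ_eq`, `nodal_univ_castHom_eq`,
`aeval_X_pow_sub_X_eq_zero`, `mem_eigenspace_castHom_iff`, `gradedMonoid_eigenspace`,
`iSupIndep_eigenspace`, `iSup_eigenspace_eq_top`, `isInternal_eigenspace`); the pieces are written
out as `fun a => Module.End.eigenspace θ.toLinearMap (ZMod.castHom (dvd_refl p) k a)` throughout
(no auxiliary definition).
-/

set_option linter.dupNamespace false -- single-problem summit: doubled namespace component is forced

noncomputable section

namespace Summit.ResolutionOfSingularities.ResolutionOfSingularities.Theorems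

namespace PCyclicGrading

open Polynomial

variable {k : Type*} [Field k] {S : Type*} [CommRing S] [Algebra k S]

/-- Over `𝔽ₚ = ZMod p`, the nodal polynomial of all of `𝔽ₚ` is `∏_{a ∈ 𝔽ₚ} (X - a) = X ^ p - X`.
(Copied from the tree's private `Theorems.Picover.EigenParameters.nodal_univ_eq`.) [folklore] -/
theorem nodal_univ_eq (p : ℕ) [Fact p.Prime] :
    Lagrange.nodal (Finset.univ : Finset (ZMod p)) (fun x => x) = X ^ p - X := by
  have hp : 1 < p := (Fact.out : p.Prime).one_lt
  have hroots : (X ^ p - X : (ZMod p)[X]).roots = Finset.univ.val := by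
    have h := FiniteField.roots_X_pow_card_sub_X (ZMod p)
    rwa [ZMod.card p] at h
  have hdeg := FiniteField.X_pow_card_sub_X_natDegree_eq (ZMod p) hp
  have hmonic : (X ^ p - X : (ZMod p)[X]).Monic :=
    Polynomial.monic_X_pow_sub (by rw [degree_X]; exact_mod_cast hp)
  have h := Polynomial.prod_multiset_X_sub_C_of_monic_of_roots_card_eq hmonic
    (by rw [hroots, hdeg, ← Finset.card_def, Finset.card_univ, ZMod.card p])
  rw [hroots] at h
  rw [Lagrange.nodal_eq, Finset.prod_eq_multiset_prod]
  exact h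

/-- Over any commutative ring `R` of characteristic `p`, the nodal polynomial of the nodes
`ι = ZMod.castHom _ R : 𝔽ₚ → R` is `∏_{a ∈ 𝔽ₚ} (X - ι a) = X ^ p - X ∈ R[X]`. [folklore] -/
theorem nodal_univ_castHom_eq (p : ℕ) [Fact p.Prime] (R : Type*) [CommRing R] [CharP R p] :
    Lagrange.nodal (Finset.univ : Finset (ZMod p)) (fun a => ZMod.castHom (dvd_refl p) R a) =
      X ^ p - X := by
  have h1 : Lagrange.nodal (Finset.univ : Finset (ZMod p)) (fun a => ZMod.castHom (dvd_refl p) R a)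
      = (Lagrange.nodal (Finset.univ : Finset (ZMod p)) (fun x => x)).map
          (ZMod.castHom (dvd_refl p) R) := by
    rw [Lagrange.nodal_eq, Lagrange.nodal_eq, Polynomial.map_prod]
    refine Finset.prod_congr rfl fun a _ => ?_
    rw [Polynomial.map_sub, map_X, map_C]
  rw [h1, nodal_univ_eq, Polynomial.map_sub, Polynomial.map_pow, map_X]

/-- `X ^ p - X` kills the linear map underlying a derivation `θ` with `θ^[p] = θ`. [folklore] -/
theorem aeval_X_pow_sub_X_eq_zero {p : ℕ} (θ : Derivation k S S)
    (hθ : ∀ s : S, (⇑θ)^[p] s = θ s) : aeval θ.toLinearMap (X ^ p - X : k[X]) = 0 := by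
  ext s
  rw [map_sub, map_pow, aeval_X, LinearMap.sub_apply, Module.End.pow_apply,
    LinearMap.zero_apply, Derivation.coeFn_coe, hθ s, sub_self]

variable {p : ℕ} [CharP k p]

/-- Membership in the degree-`a` piece (the eigenspace of the `k`-linear map `θ` for the
eigenvalue `ι a`, `ι = ZMod.castHom _ k`) is the eigenvector equation `θ s = ι a • s`.
[folklore] -/
theorem mem_eigenspace_castHom_iff {θ : Derivation k S S} {a : ZMod p} {s : S} :
    s ∈ Module.End.eigenspace θ.toLinearMap (ZMod.castHom (dvd_refl p) k a) ↔
      θ s = (ZMod.castHom (dvd_refl p) k a) • s :=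
  Module.End.mem_eigenspace_iff

/-- The eigenspace pieces form a graded monoid: `1 ∈ S_0` since `θ 1 = 0`, and
`S_a · S_b ⊆ S_{a+b}` by the Leibniz rule. [folklore] -/
theorem gradedMonoid_eigenspace (θ : Derivation k S S) :
    SetLike.GradedMonoid fun a : ZMod p =>
      Module.End.eigenspace θ.toLinearMap (ZMod.castHom (dvd_refl p) k a) where
  one_mem := mem_eigenspace_castHom_iff.mpr (by
    rw [Derivation.map_one_eq_zero, map_zero, zero_smul])
  mul_mem a b s t hs ht := mem_eigenspace_castHom_iff.mpr (by
    have hs' := mem_eigenspace_castHom_iff.mp hs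
    have ht' := mem_eigenspace_castHom_iff.mp ht
    rw [Derivation.leibniz, hs', ht', smul_eq_mul, smul_eq_mul, mul_smul_comm, mul_smul_comm,
      mul_comm t s, map_add, add_smul, add_comm])

/-- The eigenspace pieces are independent (eigenspaces of a linear map over a field for the
pairwise distinct eigenvalues `ι a`). [folklore] -/
theorem iSupIndep_eigenspace (θ : Derivation k S S) :
    iSupIndep fun a : ZMod p =>
      Module.End.eigenspace θ.toLinearMap (ZMod.castHom (dvd_refl p) k a) :=
  (Module.End.eigenspaces_iSupIndep θ.toLinearMap).comp (ZMod.castHom_injective k)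

variable [Fact p.Prime]

/-- The eigenspace pieces span: every `s` is the sum `∑_a ℓ_a(θ) s` of its Lagrange components,
and `ℓ_a(θ) s ∈ S_a` because `(X - ι a) ℓ_a` is a multiple of `X ^ p - X`, which kills `θ`.
[folklore] -/
theorem iSup_eigenspace_eq_top (θ : Derivation k S S) (hθ : ∀ s : S, (⇑θ)^[p] s = θ s) :
    ⨆ a : ZMod p, Module.End.eigenspace θ.toLinearMap (ZMod.castHom (dvd_refl p) k a) = ⊤ := by
  classical
  have hann := aeval_X_pow_sub_X_eq_zero θ hθ
  set v : ZMod p → k := fun a => ZMod.castHom (dvd_refl p) k a with hv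
  have hvinj : Function.Injective v := ZMod.castHom_injective k
  -- each Lagrange component is an eigenvector
  have hmem : ∀ (a : ZMod p) (s : S), aeval θ.toLinearMap (Lagrange.basis Finset.univ v a) s ∈
      Module.End.eigenspace θ.toLinearMap (ZMod.castHom (dvd_refl p) k a) := by
    intro a s
    have ha : a ∈ (Finset.univ : Finset (ZMod p)) := Finset.mem_univ a
    have key : (X - C (v a)) * Lagrange.basis Finset.univ v a =
        C (Lagrange.nodalWeight Finset.univ v a) * (X ^ p - X) := by
      rw [Lagrange.basis_eq_prod_sub_inv_mul_nodal_div ha,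
        ← Lagrange.nodal_erase_eq_nodal_div ha, mul_left_comm,
        ← Lagrange.nodal_eq_mul_nodal_erase (v := v) ha, hv, nodal_univ_castHom_eq]
    have h1 : aeval θ.toLinearMap ((X - C (v a)) * Lagrange.basis Finset.univ v a) = 0 := by
      rw [key, map_mul, hann, mul_zero]
    have h2 := LinearMap.congr_fun h1 s
    rw [map_mul, Module.End.mul_apply, map_sub, aeval_X, aeval_C, LinearMap.sub_apply,
      Module.algebraMap_end_apply, LinearMap.zero_apply, sub_eq_zero] at h2
    exact Module.End.mem_eigenspace_iff.mpr h2
  -- the components sum to `s`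
  have hsum : ∀ s : S, s = ∑ a, aeval θ.toLinearMap (Lagrange.basis Finset.univ v a) s := by
    intro s
    have h1 : ∑ a ∈ (Finset.univ : Finset (ZMod p)), Lagrange.basis Finset.univ v a = 1 :=
      Lagrange.sum_basis hvinj.injOn Finset.univ_nonempty
    have h2 := LinearMap.congr_fun (congrArg (aeval θ.toLinearMap) h1) s
    rw [map_sum, LinearMap.sum_apply, map_one, Module.End.one_apply] at h2
    exact h2.symm
  rw [eq_top_iff]
  intro s _
  rw [hsum s]
  exact Submodule.sum_mem _ fun a _ => Submodule.mem_iSup_of_mem a (hmem a s)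

/-- The eigenspace pieces form an internal direct sum decomposition of `S`. [folklore] -/
theorem isInternal_eigenspace (θ : Derivation k S S) (hθ : ∀ s : S, (⇑θ)^[p] s = θ s) :
    DirectSum.IsInternal fun a : ZMod p =>
      Module.End.eigenspace θ.toLinearMap (ZMod.castHom (dvd_refl p) k a) :=
  (DirectSum.isInternal_submodule_iff_iSupIndep_and_iSup_eq_top _).2
    ⟨iSupIndep_eigenspace θ, iSup_eigenspace_eq_top θ hθ⟩

end PCyclicGrading

open PCyclicGrading in
/-- **A `p`-cyclic derivation grades the ring by `ℤ/p`.** Over a field `k` of characteristic `p`,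
a `k`-derivation `θ` of a commutative `k`-algebra `S` with `θ^[p] = θ` yields a `ZMod p`-grading
`S = ⊕_a S_a` by `k`-submodules (a Mathlib `GradedAlgebra`) with `S_a = {s | θ s = ι a • s}`,
`ι = ZMod.castHom (dvd_refl p) k`. Registered signature of `Sig.stub_pCyclicGrading`, verbatim.
[folklore] -/
theorem stub_pCyclicGrading :
  ∀ (p : ℕ) [Fact p.Prime] (k : Type) [Field k] [CharP k p] (S : Type) [CommRing S] [Algebra k S]
    (θ : Derivation k S S), (∀ s : S, (⇑θ)^[p] s = θ s) →
    ∃ (𝒮 : ZMod p → Submodule k S) (_ : GradedAlgebra 𝒮),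
      ∀ (a : ZMod p) (s : S), s ∈ 𝒮 a ↔ θ s = (ZMod.castHom (dvd_refl p) k a) • s := by
  intro p _ k _ _ S _ _ θ hθ
  exact ⟨fun a => Module.End.eigenspace θ.toLinearMap (ZMod.castHom (dvd_refl p) k a),
    { (gradedMonoid_eigenspace θ) with
      toDecomposition := (isInternal_eigenspace θ hθ).chooseDecomposition },
    fun a s => mem_eigenspace_castHom_iff⟩

end Summit.ResolutionOfSingularities.ResolutionOfSingularities.Theorems

end
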